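import Summits.RiemannHypothesis.RiemannHypothesis.Theorems.JensenLogBandArcWindowMain
import Summits.RiemannHypothesis.RiemannHypothesis.Theorems.JensenLogBandZetaWindow
import Mathlib.Analysis.SpecialFunctions.Trigonometric.Bounds
import HarnessLib

/-!
# The window of the right half-arc transform with its `ζ`-amplitude (BAND line, step S5-2a)

RH ladder column JENSEN, rung J-P(P3) «log band», BAND crux `XiDerivBandRealAllRates` of route
«JensenLogBand», line «band-one-window» (u-arc, top-shell reshape), lead rh-jensen-prover g8 — step
(S5-2a) of the assembly: the WINDOW part of the TRUE arc integrand
`arcIntegrandU = arcModelIntegrand · ζ(½+u)` (`LogBandArc.arcIntegrandU_eq_model_mul_zeta`), with the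
`ζ`-amplitude `g(ψ) = ζ(½ + u(φ₀+ψ))/ζ(½ + u*)` controlled by `LogBandArc.norm_riemannZeta_div_sub_one_le`
(window right of the `1`-line by `δ`), fed into `LogBandArc.window_main_term` (S5-1, p494176).
RH-FREE. WHAT THIS IS NOT: nothing here bears on zeros of `ζ` off the line or the truth of RH.

`window_zeta_term`: in the regime of S3 (`|x| ≤ ½`, `T ≥ 100`, `ℓ_T ≥ 20`, `n ≥ 100`,
`½ ≤ h ≤ 7T/20`), for the saddle `u*` (`r = ‖u*−c‖`, `φ₀ = arg(u*−c)`, `w = S′(u*)(u*−c)²/2`),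
`0 < ψ₁ ≤ 11/320`, `rψ₁ ≤ h/20`, and a window right of the `1`-line, `1 + δ + rψ₁ ≤ Re(½ + u*)`:

  `‖∫_{−ψ₁}^{ψ₁} arcIntegrandU n r c (φ₀+ψ) dψ − I(φ₀)·(π/w)^{1/2}·ζ(½+u*)‖`
  `≤ ‖I(φ₀)‖·‖ζ(½+u*)‖·(16(1+η)n/(Re w)² + η√(π/Re w) + 2e^{−Re w ψ₁²}/(Re w ψ₁))`,
  `η = (rψ₁/δ)·e^{rψ₁/δ}`.
-/

noncomputable section

-- single-problem summit: `Summit.RiemannHypothesis.RiemannHypothesis.…` is the tree convention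
set_option linter.dupNamespace false

open Complex Real Set MeasureTheory intervalIntegral

namespace Summit.RiemannHypothesis.RiemannHypothesis.Theorems.JensenPolynomials.LogBandArc

open Literature.NumberTheory.LFunctions

variable {n : ℕ} {x T : ℝ} {ustar : ℂ}

/-- Chord ≤ arc on a circle: `‖(c + r e^{i(φ₀+ψ)}) − (c + r e^{iφ₀})‖ ≤ r|ψ|` (`r ≥ 0`). [folklore] -/
theorem norm_circleMap_sub_circleMap_le (c : ℂ) {r : ℝ} (hr : 0 ≤ r) (φ₀ ψ : ℝ) :
    ‖circleMap c r (φ₀ + ψ) - circleMap c r φ₀‖ ≤ r * |ψ| := by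
  have hfac : circleMap c r (φ₀ + ψ) - circleMap c r φ₀ =
      (r : ℂ) * cexp ((φ₀ : ℂ) * I) * (cexp (I * (ψ : ℂ)) - 1) := by
    simp only [circleMap]
    push_cast
    rw [show ((φ₀ : ℂ) + (ψ : ℂ)) * I = (φ₀ : ℂ) * I + I * (ψ : ℂ) by ring, Complex.exp_add]
    ring
  rw [hfac, norm_mul, norm_mul, Complex.norm_real, Complex.norm_exp_ofReal_mul_I, mul_one,
    Real.norm_eq_abs, abs_of_nonneg hr]
  have h1 : ‖cexp (I * (ψ : ℂ)) - 1‖ ≤ ‖ψ‖ := Real.norm_exp_I_mul_ofReal_sub_one_le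
  rw [Real.norm_eq_abs] at h1
  exact mul_le_mul_of_nonneg_left h1 hr

/-- **Window with the `ζ`-amplitude (S5-2a).** See the module docstring. [folklore] -/
theorem window_zeta_term (hx : |x| ≤ 1 / 2) (hT : 100 ≤ T) (hℓ : 20 ≤ ell T)
    (hn : 100 ≤ n) (hh : 1 / 2 ≤ bandRadius n T) (hhT : bandRadius n T ≤ 7 / 20 * T)
    (hustar : ‖ustar - ((x : ℂ) + (T : ℂ) * I + bandRadius n T)‖ ≤ 3 / 5 * bandRadius n T)
    (hS : arcSaddleFn n ((x : ℂ) + (T : ℂ) * I) ustar = 0) {ψ₁ δ : ℝ} (hψ₁ : 0 < ψ₁)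
    (hψ₁s : ψ₁ ≤ 11 / 320)
    (hψ₁r : ‖ustar - ((x : ℂ) + (T : ℂ) * I)‖ * ψ₁ ≤ 1 / 20 * bandRadius n T) (hδ : 0 < δ)
    (hwin : 1 + δ + ‖ustar - ((x : ℂ) + (T : ℂ) * I)‖ * ψ₁ ≤ (1 / 2 + ustar).re) :
    let c : ℂ := (x : ℂ) + (T : ℂ) * I
    let r : ℝ := ‖ustar - c‖
    let φ₀ : ℝ := Complex.arg (ustar - c)
    let w : ℂ := deriv (arcSaddleFn n c) ustar * (ustar - c) ^ 2 / 2
    let η : ℝ := r * ψ₁ / δ * Real.exp (r * ψ₁ / δ)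
    ‖(∫ ψ in (-ψ₁)..ψ₁, arcIntegrandU n r c (φ₀ + ψ)) -
        arcModelIntegrand n r c φ₀ * ((π : ℂ) / w) ^ (1 / 2 : ℂ) * riemannZeta (1 / 2 + ustar)‖ ≤
      ‖arcModelIntegrand n r c φ₀‖ * ‖riemannZeta (1 / 2 + ustar)‖ *
        (4 * (1 + η) * (4 * n) / w.re ^ 2 + η * Real.sqrt (π / w.re) +
          2 / (w.re * ψ₁) * Real.exp (-w.re * ψ₁ ^ 2)) := by
  intro c r φ₀ w η
  have hT0 : 0 < T := by linarith
  obtain ⟨hre_pos, -, -, -, -⟩ := arcSaddle_polar_bounds hx hT hℓ hn hh hhT hustar hS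
  have hw0 : ustar - c ≠ 0 := by
    intro h0
    have h' : (0 : ℝ) < (ustar - c).re := hre_pos
    rw [h0] at h'; simp at h'
  have hr0 : 0 < r := norm_pos_iff.2 hw0
  have hustar_eq : ustar = circleMap c r φ₀ := by
    show ustar = c + (‖ustar - c‖ : ℝ) * cexp ((Complex.arg (ustar - c) : ℝ) * I)
    rw [Complex.norm_mul_exp_arg_mul_I (ustar - c)]; ring
  -- the base point `s* = ½ + u*` and its distance to the `1`-line
  set s₀ : ℂ := 1 / 2 + ustar with hs₀
  have hrψ : 0 ≤ r * ψ₁ := mul_nonneg hr0.le hψ₁.le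
  have hs₀re : 1 + δ ≤ s₀.re := by
    have : (1 / 2 + ustar).re = s₀.re := rfl
    linarith
  have hζ₀ : riemannZeta s₀ ≠ 0 :=
    riemannZeta_ne_zero_of_one_lt_re (by linarith)
  -- the arc points of the window stay right of `1 + δ`
  have harc_re : ∀ ψ : ℝ, |ψ| ≤ ψ₁ →
      ‖(1 / 2 + circleMap c r (φ₀ + ψ)) - s₀‖ ≤ r * ψ₁ ∧
        1 + δ ≤ (1 / 2 + circleMap c r (φ₀ + ψ)).re := by
    intro ψ hψ
    have hdist : ‖(1 / 2 + circleMap c r (φ₀ + ψ)) - s₀‖ ≤ r * ψ₁ := by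
      have : (1 / 2 + circleMap c r (φ₀ + ψ)) - s₀ = circleMap c r (φ₀ + ψ) - circleMap c r φ₀ := by
        rw [hs₀, ← hustar_eq]; ring
      rw [this]
      exact (norm_circleMap_sub_circleMap_le c hr0.le φ₀ ψ).trans
        (mul_le_mul_of_nonneg_left hψ hr0.le)
    refine ⟨hdist, ?_⟩
    have hre_diff : |((1 / 2 + circleMap c r (φ₀ + ψ)) - s₀).re| ≤ r * ψ₁ :=
      (Complex.abs_re_le_norm _).trans hdist
    have := abs_le.1 hre_diff
    have hsub : ((1 / 2 + circleMap c r (φ₀ + ψ)) - s₀).re =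
        (1 / 2 + circleMap c r (φ₀ + ψ)).re - s₀.re := by simp
    rw [hsub] at this
    linarith [this.1]
  -- the amplitude `g`
  set g : ℝ → ℂ := fun ψ => riemannZeta (1 / 2 + circleMap c r (φ₀ + ψ)) / riemannZeta s₀ with hg
  have hη0 : 0 ≤ η := by positivity
  have hgb : ∀ ψ ∈ Icc (-ψ₁) ψ₁, ‖g ψ - 1‖ ≤ η := by
    intro ψ hψ
    have hψ' : |ψ| ≤ ψ₁ := abs_le.2 ⟨hψ.1, hψ.2⟩
    obtain ⟨hdist, hre⟩ := harc_re ψ hψ'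
    exact norm_riemannZeta_div_sub_one_le_of_norm_le hδ hs₀re hre hdist
  -- continuity of `g` on the window (indeed on a neighbourhood: we only need the closed window)
  have hgc : ContinuousOn g (Icc (-ψ₁) ψ₁) := by
    -- restrict to the window through a clamped reparametrisation is unnecessary: prove
    -- `ContinuousAt` at every point of the window directly
    refine fun ψ hψ => ContinuousAt.continuousWithinAt ?_
    have hψ' : |ψ| ≤ ψ₁ := abs_le.2 ⟨hψ.1, hψ.2⟩
    obtain ⟨-, hre⟩ := harc_re ψ hψ'
    have hne : (1 / 2 : ℂ) + circleMap c r (φ₀ + ψ) ≠ 1 := by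
      intro h0
      have := congrArg Complex.re h0
      rw [this] at hre; simp at hre; linarith
    have harc : Continuous fun ψ : ℝ => (1 / 2 : ℂ) + circleMap c r (φ₀ + ψ) :=
      continuous_const.add ((continuous_circleMap c r).comp (continuous_const.add continuous_id))
    have h1 : ContinuousAt (fun ψ : ℝ => riemannZeta (1 / 2 + circleMap c r (φ₀ + ψ))) ψ :=
      ContinuousAt.comp (g := riemannZeta) (f := fun ψ : ℝ => (1 / 2 : ℂ) + circleMap c r (φ₀ + ψ))
        ((differentiableAt_riemannZeta hne).continuousAt) harc.continuousAt
    exact h1.div_const _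
  -- S5-1 with this amplitude
  have hmain := window_main_term hx hT hℓ hn hh hhT hustar hS hψ₁ hψ₁s hψ₁r hη0 hgc hgb
  -- the true integrand on the window is `I · ζ(s*) · g`
  have hwin_eq : ∀ ψ ∈ uIcc (-ψ₁) ψ₁,
      arcIntegrandU n r c (φ₀ + ψ) = riemannZeta s₀ * (arcModelIntegrand n r c (φ₀ + ψ) * g ψ) := by
    intro ψ hψ
    rw [uIcc_of_le (by linarith)] at hψ
    have hψ' : |ψ| ≤ ψ₁ := abs_le.2 ⟨hψ.1, hψ.2⟩
    have ht : r * |(φ₀ + ψ) - φ₀| ≤ 1 / 20 * bandRadius n T := by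
      rw [show φ₀ + ψ - φ₀ = ψ by ring]
      exact (mul_le_mul_of_nonneg_left hψ' hr0.le).trans hψ₁r
    obtain ⟨-, hre_pos', hne1, -, -⟩ := window_admissible hx hT hℓ hn hh hhT hustar hS ht
    rw [arcIntegrandU_eq_model_mul_zeta n r c (φ₀ + ψ) hre_pos' hne1, hg]
    field_simp
  have hint_eq : (∫ ψ in (-ψ₁)..ψ₁, arcIntegrandU n r c (φ₀ + ψ)) =
      riemannZeta s₀ * ∫ ψ in (-ψ₁)..ψ₁, arcModelIntegrand n r c (φ₀ + ψ) * g ψ := by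
    rw [← intervalIntegral.integral_const_mul]
    exact intervalIntegral.integral_congr hwin_eq
  -- conclude
  have hfac : (∫ ψ in (-ψ₁)..ψ₁, arcIntegrandU n r c (φ₀ + ψ)) -
      arcModelIntegrand n r c φ₀ * ((π : ℂ) / w) ^ (1 / 2 : ℂ) * riemannZeta s₀ =
      riemannZeta s₀ * ((∫ ψ in (-ψ₁)..ψ₁, arcModelIntegrand n r c (φ₀ + ψ) * g ψ) -
        arcModelIntegrand n r c φ₀ * ((π : ℂ) / w) ^ (1 / 2 : ℂ)) := by
    rw [hint_eq]; ring
  rw [hfac, norm_mul]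
  calc ‖riemannZeta s₀‖ * ‖(∫ ψ in (-ψ₁)..ψ₁, arcModelIntegrand n r c (φ₀ + ψ) * g ψ) -
        arcModelIntegrand n r c φ₀ * ((π : ℂ) / w) ^ (1 / 2 : ℂ)‖
      ≤ ‖riemannZeta s₀‖ * (‖arcModelIntegrand n r c φ₀‖ *
          (4 * (1 + η) * (4 * n) / w.re ^ 2 + η * Real.sqrt (π / w.re) +
            2 / (w.re * ψ₁) * Real.exp (-w.re * ψ₁ ^ 2))) :=
        mul_le_mul_of_nonneg_left hmain (norm_nonneg _)
    _ = ‖arcModelIntegrand n r c φ₀‖ * ‖riemannZeta s₀‖ *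
          (4 * (1 + η) * (4 * n) / w.re ^ 2 + η * Real.sqrt (π / w.re) +
            2 / (w.re * ψ₁) * Real.exp (-w.re * ψ₁ ^ 2)) := by ring

end Summit.RiemannHypothesis.RiemannHypothesis.Theorems.JensenPolynomials.LogBandArc

end
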